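import Summits.NavierStokesRegularity.TurbBounds.CouetteForms
import HarnessLib

/-!
# Two-field (plane Couette) shear rule: the per-mode algebraic assembly (rbsdp SPEC §3.5–3.7)

Cell `turb-bounds` (pub-turb), shear lane, pub-turb-shear gen 6 (2026-08-22); v2 lane (not proposed before the PF1 cut). The Couette analogue of
`ShearSpecPieces.mode_assembly`: from the kernel-checked **piece positivity** of a mode,
`0 ≤ ψᵀ(c·Dc + Σ_p ĝ_p G⁽ᵖ⁾ + T·CT)ψ` for every `ψ` (R-C200 `EvalBlock<m>`: `den·Mf = pieces`, `Mf ≽ 0`), evaluated at `ψ = ` the kept coordinates of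
`u = (c; d)` (`c, a, b` the Legendre coefficients of `W_xx, W_x, W` with the clamped walls, `d, e` those of `Θ_x, Θ`), the two **tail lemmas**
`CouetteTailSeq.tailW_seq / tailT_seq`, the Young bound `|X_t| ≤ T(ε‖w̃₀‖² + ‖θ̃₀‖²/ε)` on the un-tracked coupling remainder, and the row's two
**tail slacks** `16·KINV2·c ≥ T·ε·λ_W`, `4c ≥ T·λ_T/ε` (R-C200 `TailSlack`), conclude

`0 ≤ c·(cᵀXWc + tails) + c·(dᵀXTd + tails) + 2Σ_p ĝ_p cᵀE_p d + X_t`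

— the right-hand side is, by `ShearBridgeNormsTF.normsW_split / normsT_split` and the coupling split, exactly the mode-`m` quadratic form
`c(16k⁻²‖W_xx‖² + 8‖W_x‖² + k²‖W‖²) + c(4‖Θ_x‖² + k²‖Θ‖²) + 2∫g_τ W Θ` of SPEC 3.2 (the bridge file supplies that dictionary; here everything is
at the level of coefficient sequences and is PURE ALGEBRA).

Main results: `qform_dcPiece`, `qform_gPiece`, `qform_ctPiece` (the pieces as forms of `(c; d)`), `couette_mode_assembly`.
HONEST FRAMING: rigorous bounds for the stated PDE and boundary conditions; no claim about physical turbulence beyond the bound.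
-/

set_option linter.style.longLine false

namespace Summit.NavierStokesRegularity.TurbBounds.ShearSpecPiecesTF

open Finset Summit.NavierStokesRegularity.TurbBounds.LadderTail Summit.NavierStokesRegularity.TurbBounds.ShearTailSeq
  Summit.NavierStokesRegularity.TurbBounds.ShearSpecPieces

/-! ### shapes of the tail tables -/

/-- `GW0` is `LW × LW`. -/
theorem shaped_gw0Tab (N P : ℕ) : Shaped (N + P + 3) (N + P + 3) (gw0Tab N P) := by
  unfold gw0Tab; exact shaped_gramSum _ _ _ (length_rows_tfD0 N P) (shaped_zeroMat _ _)

/-- `HW` is `LW × LW`. -/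
theorem shaped_hwTab (N P : ℕ) : Shaped (N + P + 3) (N + P + 3) (hwTab N P) :=
  shaped_gramSum _ _ _ (length_rows_tfD1 N P) (shaped_diag_range _ _)

/-- `GT0` is `LT × LT`. -/
theorem shaped_gt0Tab (N P : ℕ) : Shaped (N + P + 2) (N + P + 2) (gt0Tab N P) := by
  unfold gt0Tab; exact shaped_gramSum _ _ _ (length_rows_tfDT N P) (shaped_zeroMat _ _)

/-- `diag(HT)` is `LT × LT`. -/
theorem shaped_htDiag (N P : ℕ) : Shaped (N + P + 2) (N + P + 2) (diagMat (htDiag N P)) :=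
  shaped_diag_range (N + P + 2) _

/-- `qform (a•(G+H)) = a·(qform G + qform H)` for same-shaped `G, H`. -/
theorem qform_scale_add (a : ℚ) (G H : List (List ℚ)) {n : ℕ} (hG : Shaped n n G) (hH : Shaped n n H) (L : ℕ) (x : ℕ → ℝ) :
    qform (matScale a (matAdd G H)) L x = (a : ℝ) * (qform G L x + qform H L x) := by
  rw [qform_of_entry (matScale a (matAdd G H)) G H a a L x fun i j => by rw [get2_matScale, get2_matAdd G H hG hH]; push_cast; ring]
  ring

/-! ### the three pieces as forms of `(c; d)` -/

/-- The kept-coordinate vector `ψ` of `u = (c; d)`. -/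
def psiOf (N P : ℕ) (c d : ℕ → ℝ) (i : ℕ) : ℝ := fullVec (N + P + 3) c d (keepFun N P i)

/-- **`ψᵀ Dc ψ = cᵀ XW c + dᵀ XT d`.** -/
theorem qform_dcPiece (N P : ℕ) (KINV2 K2 : ℚ) {c d : ℕ → ℝ} (hc0 : c 0 = 0) (hc1 : c 1 = 0) (hd0 : d 0 = 0) :
    qform (dcPiece N P KINV2 K2) (2 * (N + P + 1)) (psiOf N P c d)
      = qform (xwTab N P KINV2 K2) (N + P + 3) c + qform (xtTab N P K2) (N + P + 2) d := by
  unfold dcPiece psiOf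
  rw [qform_selectTab N P _ hc0 hc1 hd0, show 2 * N + 2 * P + 5 = (N + P + 3) + (N + P + 2) by ring, form_blockDiag]

/-- **`ψᵀ G⁽ᵖ⁾ ψ = 2·cᵀ E_p d`.** -/
theorem qform_gPiece (N P p : ℕ) {c d : ℕ → ℝ} (hc0 : c 0 = 0) (hc1 : c 1 = 0) (hd0 : d 0 = 0) :
    qform (gPiece N P p) (2 * (N + P + 1)) (psiOf N P c d) = 2 * rform (tfETab N P p) (N + P + 3) (N + P + 2) c d := by
  unfold gPiece psiOf
  rw [qform_selectTab N P _ hc0 hc1 hd0, show 2 * N + 2 * P + 5 = (N + P + 3) + (N + P + 2) by ring, form_offSym]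

/-- **`ψᵀ CT ψ = −ε(cᵀGW0c + cᵀHWc) − (dᵀGT0d + dᵀHTd)/ε`.** -/
theorem qform_ctPiece (N P : ℕ) (eps : ℚ) {c d : ℕ → ℝ} (hc0 : c 0 = 0) (hc1 : c 1 = 0) (hd0 : d 0 = 0) :
    qform (ctPiece N P eps) (2 * (N + P + 1)) (psiOf N P c d)
      = -(eps : ℝ) * (qform (gw0Tab N P) (N + P + 3) c + qform (hwTab N P) (N + P + 3) c)
        + (-1 / (eps : ℝ)) * (qform (gt0Tab N P) (N + P + 2) d + qform (diagMat (htDiag N P)) (N + P + 2) d) := by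
  unfold ctPiece psiOf
  rw [qform_selectTab N P _ hc0 hc1 hd0, show 2 * N + 2 * P + 5 = (N + P + 3) + (N + P + 2) by ring, form_blockDiag,
    qform_scale_add _ _ _ (shaped_gw0Tab N P) (shaped_hwTab N P), qform_scale_add _ _ _ (shaped_gt0Tab N P) (shaped_htDiag N P)]
  push_cast; ring

/-! ### the assembly -/

/-- **Couette per-mode assembly** (SPEC 3.5–3.7, pure algebra; all tail windows of a common length `L ≥ P`).
Data: the row constants `KINV2 = 1/k², K2 = k², cK = a−1 ≥ 0`, the mode's Young weight `ε > 0` and `T = |τ'|/√Gr ≥ 0`, the profile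
coefficients `ĝ_p`; the ladders `c → a → b` (`W_xx → W_x → W`, walls at `−1`) with `c₀ = c₁ = 0` (walls at `+1`) and `d → e` (`Θ_x → Θ`) with
`d₀ = 0`; the piece positivity `hQ` at `ψ = psiOf c d`; the Young bound `hX` on the coupling remainder `X_t`; the two tail slacks.
Conclusion: the tracked form plus ALL the Parseval tails plus the coupling is `≥ 0`. -/
theorem couette_mode_assembly (N P : ℕ) (KINV2 K2 cK eps : ℚ) (T : ℝ) (ghat : ℕ → ℝ) {c a b d e : ℕ → ℝ}
    (hA : IsLadder c a) (h0a : a 0 = c 0 - c 1 / 3) (hB : IsLadder a b) (h0b : b 0 = a 0 - a 1 / 3) (hc0 : c 0 = 0) (hc1 : c 1 = 0)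
    (hE : IsLadder d e) (h0e : e 0 = d 0 - d 1 / 3) (hd0 : d 0 = 0)
    (L : ℕ) (hPL : P ≤ L) {Xt : ℝ} (hcK : 0 ≤ (cK : ℝ)) (hK2 : 0 ≤ (K2 : ℝ)) (heps : 0 < (eps : ℝ)) (hT : 0 ≤ T)
    (hX : |Xt| ≤ T * ((eps : ℝ) * ∑ k ∈ range L, w (N + 1 + k) * b (N + 1 + k) ^ 2 + (∑ k ∈ range L, w (N + 1 + k) * e (N + 1 + k) ^ 2) / (eps : ℝ)))
    (hQ : 0 ≤ (cK : ℝ) * qform (dcPiece N P KINV2 K2) (2 * (N + P + 1)) (psiOf N P c d)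
          + ∑ p ∈ range (P + 1), ghat p * qform (gPiece N P p) (2 * (N + P + 1)) (psiOf N P c d)
          + T * qform (ctPiece N P eps) (2 * (N + P + 1)) (psiOf N P c d))
    (slackW : 0 ≤ 16 * (KINV2 : ℝ) * (cK : ℝ) - T * (eps : ℝ) * (lam (N + P) * lam (N + P + 1)))
    (slackT : 0 ≤ 4 * (cK : ℝ) - T * lam (N + P) / (eps : ℝ)) :
    0 ≤ (cK : ℝ) * (qform (xwTab N P KINV2 K2) (N + P + 3) c
            + (16 * (KINV2 : ℝ) * ∑ k ∈ range L, w (N + P + 3 + k) * c (N + P + 3 + k) ^ 2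
               + 8 * ∑ k ∈ range L, w (N + P + 2 + k) * a (N + P + 2 + k) ^ 2
               + (K2 : ℝ) * ∑ k ∈ range L, w (N + P + 1 + k) * b (N + P + 1 + k) ^ 2))
        + (cK : ℝ) * (qform (xtTab N P K2) (N + P + 2) d
            + (4 * ∑ k ∈ range L, w (N + P + 2 + k) * d (N + P + 2 + k) ^ 2
               + (K2 : ℝ) * ∑ k ∈ range L, w (N + P + 1 + k) * e (N + P + 1 + k) ^ 2))
        + 2 * ∑ p ∈ range (P + 1), ghat p * rform (tfETab N P p) (N + P + 3) (N + P + 2) c d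
        + Xt := by
  -- the pieces as forms of (c; d)
  rw [qform_dcPiece N P KINV2 K2 hc0 hc1 hd0, qform_ctPiece N P eps hc0 hc1 hd0] at hQ
  have eG : ∑ p ∈ range (P + 1), ghat p * qform (gPiece N P p) (2 * (N + P + 1)) (psiOf N P c d)
      = 2 * ∑ p ∈ range (P + 1), ghat p * rform (tfETab N P p) (N + P + 3) (N + P + 2) c d := by
    rw [Finset.mul_sum]
    exact Finset.sum_congr rfl fun p _ => by rw [qform_gPiece N P p hc0 hc1 hd0]; ring
  rw [eG] at hQ
  -- the tail tables as explicit tails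
  rw [gw0_form hA h0a hB h0b, hw_form hA h0a, gt0_form hE h0e, ht_form] at hQ
  have eInv : (-1 : ℝ) / (eps : ℝ) = -(1 / (eps : ℝ)) := by ring
  rw [eInv] at hQ
  -- the tail lemmas
  have tW := tailW_seq hA hB N P L hPL
  have tT := tailT_seq hE N P L hPL
  -- abbreviations for the sign bookkeeping
  set B0 := ∑ k ∈ range L, w (N + 1 + k) * b (N + 1 + k) ^ 2
  set E0 := ∑ k ∈ range L, w (N + 1 + k) * e (N + 1 + k) ^ 2
  set T2 := ∑ k ∈ range L, w (N + P + 3 + k) * c (N + P + 3 + k) ^ 2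
  set T1T := ∑ k ∈ range L, w (N + P + 2 + k) * d (N + P + 2 + k) ^ 2
  have hB0f : 0 ≤ ∑ k ∈ range P, w (N + 1 + k) * b (N + 1 + k) ^ 2 := Finset.sum_nonneg fun k _ => mul_nonneg (w_pos _).le (sq_nonneg _)
  have hT1W : 0 ≤ ∑ k ∈ range L, w (N + P + 2 + k) * a (N + P + 2 + k) ^ 2 := Finset.sum_nonneg fun k _ => mul_nonneg (w_pos _).le (sq_nonneg _)
  have hT0W : 0 ≤ ∑ k ∈ range L, w (N + P + 1 + k) * b (N + P + 1 + k) ^ 2 := Finset.sum_nonneg fun k _ => mul_nonneg (w_pos _).le (sq_nonneg _)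
  have hT0T : 0 ≤ ∑ k ∈ range L, w (N + P + 1 + k) * e (N + P + 1 + k) ^ 2 := Finset.sum_nonneg fun k _ => mul_nonneg (w_pos _).le (sq_nonneg _)
  have hT2 : 0 ≤ T2 := Finset.sum_nonneg fun k _ => mul_nonneg (w_pos _).le (sq_nonneg _)
  have hT1T : 0 ≤ T1T := Finset.sum_nonneg fun k _ => mul_nonneg (w_pos _).le (sq_nonneg _)
  have hXl : -(T * ((eps : ℝ) * B0 + E0 / (eps : ℝ))) ≤ Xt := (abs_le.mp hX).1
  -- Young-weighted tail bounds, multiplied out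
  have hε0 : 0 ≤ (eps : ℝ) := heps.le
  have hε1 : 0 ≤ 1 / (eps : ℝ) := by positivity
  have tW' := mul_le_mul_of_nonneg_left (mul_le_mul_of_nonneg_left tW hε0) hT
  have tT' := mul_le_mul_of_nonneg_left (mul_le_mul_of_nonneg_left tT hε1) hT
  have eE0 : E0 / (eps : ℝ) = 1 / (eps : ℝ) * E0 := by ring
  rw [eE0] at hXl
  -- the slack terms
  have sW := mul_le_mul_of_nonneg_right slackW hT2
  have sT := mul_le_mul_of_nonneg_right slackT hT1T
  have eT : T * lam (N + P) / (eps : ℝ) = T * (1 / (eps : ℝ)) * lam (N + P) := by ring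
  rw [eT] at sT
  -- drop the nonnegative untracked tails with nonnegative coefficients
  have d1 : 0 ≤ (cK : ℝ) * (8 * ∑ k ∈ range L, w (N + P + 2 + k) * a (N + P + 2 + k) ^ 2) := mul_nonneg hcK (mul_nonneg (by norm_num) hT1W)
  have d2 : 0 ≤ (cK : ℝ) * ((K2 : ℝ) * ∑ k ∈ range L, w (N + P + 1 + k) * b (N + P + 1 + k) ^ 2) := mul_nonneg hcK (mul_nonneg hK2 hT0W)
  have d3 : 0 ≤ (cK : ℝ) * ((K2 : ℝ) * ∑ k ∈ range L, w (N + P + 1 + k) * e (N + P + 1 + k) ^ 2) := mul_nonneg hcK (mul_nonneg hK2 hT0T)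
  linarith [hQ, hXl, tW', tT', sW, sT, d1, d2, d3]

end Summit.NavierStokesRegularity.TurbBounds.ShearSpecPiecesTF
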